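import Literature.MathematicalPhysics.QuantumFieldTheory.Balaban1983to89.B8Eq184Proof
import Literature.MathematicalPhysics.QuantumFieldTheory.Balaban1983to89.B8Eq151V2Divergence

/-!
# `Balaban1983to89.B8Eq188Proof` — T. Bałaban, *Spaces of regular gauge field configurations on a lattice and gauge
# fixing conditions*, Commun. Math. Phys. **99** (1985) 75–102 [Balaban1985RegularSpaces]: (1.88)–(1.89) p. 91 ON THE
# LATTICE — the covariant divergence of the expansion (1.84), `(D*(1/iη) log U₁^{u′⁻¹})(x) = e^{−i ad_{λ(x)}}(D*A)(x)
# + g(i ad_{λ(x)})(D*Dλ)(x) + 𝔉₃`, PROVED on the concrete `ℤᵈ` carrier as an exact identity with the remainder `𝔉₃`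
# EXPLICIT and bounded (file 3 of the (1.81)–(1.89) chain; files 1–2 = `B8Eq182Proof`, `B8Eq184Proof`)

statement-level skeleton of published theorems with citation tags; proofs where landed; nothing here is a claim about the Yang–Mills mass gap

PDF held: `paper:balaban1985-cmp99-regular-spaces-gauge-fixing` (journal page = PDF page + 74); [3] = [Balaban1985Averaging]
`paper:balaban1985-cmp98-averaging` (journal page = PDF page + 16).  READ AS IMAGES for this module (renders
`run/shared/lean/pub/pub-balaban/b2b-balaban-ref1/pages/…-x2.png`): B8 pp. 76, 89, 90, 91 [PDF 2, 15, 16, 17].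

WHAT IS REPRODUCED.  SKELETON row **B8.Eq1.87** ((1.86)–(1.89) p. 91; cell `lit-balaban`, Phase 2, seat p05 gen 2,
referee ref-4, owner r05; HOME `run/shared/lean/pub/lit-balaban/`, seat dir `lit-balaban-p05/`), its sub-display
(1.88)–(1.89).  The row's head is `proved-existing` through `B8Eq186AdCommutator` (audit cell `pub-balaban`), which
kernel-proves (1.86)–(1.87) — the commutation of `D*_μ` past `(ad_λ)ⁿ` — and majorants for the truncated power series,
and treats (1.88)–(1.89) only as the subject of its objection G-B8-11(b).  This file proves the display (1.88) ITSELF,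
for the lineage's concrete objects and as an EXACT identity: `D*_μ` = the backward covariant derivative (1.1)
`B8Ineq132.covDeriv`, `D_μ` = `B8Ineq132.covDerivFwd`, `U₁^{u′⁻¹}` = the moving-frame action (1.17)
`B7Eq92Concrete.mgauge` of `u′⁻¹ = e^{−iλ}` on `U₁ = e^{iηA}` (`B8Eq184Proof.gaugeExp/cfgExp`), `(1/iη) log` =
`η⁻¹ • I⁻¹ • MatrixLog.mlog`, `e^{−i ad_{λ(x)}}X = R(u′(x)⁻¹)X` = `conjR`, `g(i ad_{λ(x)})X` = `B8Eq182Proof.gAd X (λ x)`,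
in an arbitrary complete normed `ℂ`-algebra `𝔸` with `‖1‖ = 1`, with the remainder `𝔉₃` an EXPLICIT function
(`frakF3`) of the remainders `𝔉₁`, `𝔉₂` of (1.82)–(1.85) (`B8Eq182Proof.frakF1/frakF2`) and a bound (1.89) with constants.

THE PRINTED TEXT (p. 90 [PDF 16] last lines, p. 91 [PDF 17], verbatim).  *"Now we apply the derivative D* to the
expression on the right-hand side of (1.84). ηD* is a bounded operator, hence D*η𝔉₁ satisfies the bound (1.85). The
operators R(u′⁻¹(b₋)) = e^{−i ad_{λ(b₋)}} and g(i ad_{λ(b₋)}) are given by power series in ad_{λ(b₋)}. Let us consider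
for example a term (ad_{λ(b₋)})ⁿA_b,  ηD*_μ(ad_{λ(x)})ⁿA_μ(x) = R(U₀(x, x − ηe_μ))(ad_{λ(x−ηe_μ)})ⁿA_μ(x − ηe_μ) −
(ad_{λ(x)})ⁿA_μ(x) = … (1.86) hence D*_μ(ad_{λ(x)})ⁿA_μ(x) = (ad_{λ(x)})ⁿ(D*_μA_μ)(x) + P_n(λ(x), D*_μλ(x), A_μ(x),
A_μ(x − ηe_μ)), (1.87) and  (D*(1/iη) log U₁^{u′⁻¹})(x) = e^{−i ad_{λ(x)}}(D*A)(x) + g(i ad_{λ(x)})(D*Dλ)(x) +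
𝔉₃(λ(x), Dλ, A), (1.88) where 𝔉₃ depends on (Dλ)(b), A_b for b ∈ st(x) and satisfies |𝔉₃(λ(x), Dλ, A)| ≦
O(1)|Dλ||A|. (1.89)"*  Context: (1.84)–(1.85) p. 90 (module docstring of `B8Eq184Proof`); (1.1) p. 76 [PDF 2]:
*"(D^{η*}_{U,μ}F)(x) = η⁻¹(R(U(x, x − ηe_μ))F(x − ηe_μ) − F(x)), (1.1)"* (`D = D^η_{U₀}`, p. 89); p. 91 l. 13: *"If it was
equal to Q′λ, then D*Dλ = Δλ would belong to the subspace …"*.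

DICTIONARY print ↦ Lean (conventions of `B8Eq184Proof`: sites `Site d = ℤᵈ`, spacing = the explicit real `η`; a bond
`b = ⟨x, x + ηe_μ⟩ ↦ (x, μ)`; `st(x)` ∋ the bonds `(x, μ)` and `(x − e_μ, μ)`; `i ↦ Complex.I`; `U₀(x, x − ηe_μ) =
U₀(x − ηe_μ, x)⁻¹ ↦ (U₀ (x - e μ) μ)⁻¹`).  `(1/iη) log (U₁^{u′⁻¹})_b` as a bond field ↦ **`logCfg η U₀ lam A`**;
`D*_μ` ↦ `covDeriv η U₀ μ`, `D*B = Σ_μ D*_μB_μ` for a bond field `B` (READING (R1)); `(D*A)(x)` ↦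
`∑ μ, covDeriv η U₀ μ (fun y => A y μ) x`, `(D*Dλ)(x)` ↦ `∑ μ, covDeriv η U₀ μ (covDerivFwd η U₀ μ lam) x`;
`e^{−i ad_{λ(x)}}X = R(e^{−iλ(x)})X` ↦ `conjR (gaugeExp lam x)⁻¹ X`; `g(i ad_{λ(x)})X` ↦ `gAd X (lam x)`;
`𝔉₃` ↦ `∑ μ, frakF3 η U₀ lam A x μ` (per-direction pieces **`frakF3`**, explicit — print leaves `𝔉₃` unnamed).

WHAT THIS FILE PROVES (kernel-checked, 0 sorry, axioms standard).  **`eq188_dir`** — (1.88) direction by direction: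
`D*_μ[(1/iη) log (U₁^{u′⁻¹})_{(·,μ)}](x) = R(u′(x)⁻¹)(D*_μA_μ)(x) + g(i ad_{λ(x)})(D*_μD_μλ)(x) + 𝔉₃,μ(x)` EXACTLY,
under `η > 0`, `|λ(x)| ≤ 1/12`, `η|(D_μλ)(x)| ≤ 1/70`, `η|(D*_μλ)(x)| ≤ 1/70`, `η|R(U₀(x, x − ηe_μ))A_μ(x − ηe_μ)| ≤ 1/12`,
with `𝔉₃,μ` the EXPLICIT `frakF3`; **`eq188`** — the display summed over `μ`, i.e. (1.88) as printed;
**`norm_frakF3_le`** — `|𝔉₃,μ(x)| ≤ 41(|(D*_μλ)(x)|² + |(D_μλ)(x)|²) + 17(|R(U₀(x, x−ηe_μ))A_μ(x−ηe_μ)|·|(D*_μλ)(x)| +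
|A_μ(x)|·|(D_μλ)(x)|)` (also needs `η|A_μ(x)| ≤ 1/12`); **`eq188_printed`** — for `U₀(x − ηe_μ, x)` in the norm-one
subgroup `U1 ⊇ U(N)` the same in the printed variables `|(Dλ)(b)|`, `|A_b|`, `b ∈ st(x)`.  On the way: **`gAd_add`**,
**`gAd_sum`** (`g(i ad_Y)` is additive: it is the differential of `exp`, [3] (40), `B7Eq38Remainder.deriv_Z39_eq`),
**`Rc_mgauge_shift`** (transport of (1.81) from the bond `(x − ηe_μ, x)` to `x`), **`eq188_alg`** (the identity behind (1.88)).

THE ROUTE (ours; print's termwise route is (1.86)–(1.87)).  `η(D*_μΦ_μ)(x) = R(U₀(x, x − ηe_μ))Φ_μ(x − ηe_μ) − Φ_μ(x)`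
for `Φ_μ = (1/iη) log (U₁^{u′⁻¹})_{(·,μ)}`, and `log` commutes with `R` ([3] (57), `B7Eq92Concrete.mlog_Rc`), so the first
term is `(1/iη) log` of the TRANSPORTED bond variable `R(U₀(x, x − ηe_μ))[u′⁻¹(x − ηe_μ)U₁(x − ηe_μ, x)R₀u′(x)] =
e^{−i(λ + ηa)}e^{iηY}e^{iλ}`, `λ = λ(x)`, `a = (D*_μλ)(x)`, `Y = R(U₀(x, x − ηe_μ))A_μ(x − ηe_μ)` ((1.1):
`R(U₀(x, x − ηe_μ))λ(x − ηe_μ) = λ(x) + ηa`).  KEY: `e^{−i(λ+ηa)}e^{iηY}e^{iλ} = (e^{−iηR(e^{−iλ})Y}·e^{−iλ}e^{iλ+iηa})⁻¹`,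
so by `log X⁻¹ = −log X` and the SAME two expansions as in (1.82)/(1.84) ([3] (41), (31): `B8Eq182Proof.eq182_alg`, the
definition of `F185`) `(1/i) log(e^{−i(λ+ηa)}e^{iηY}e^{iλ}) = ηR(e^{−iλ})Y − ηg(i ad_λ)a − η²𝔉₁(λ, a) − η²𝔉₂(λ, a, −Y)`
(`eq188_alg`) with the SAME `λ = λ(x)` in every slot — no regularity of `Y ↦ g(i ad_Y)` is needed; subtracting (1.84)
at `x` (`B8Eq184Proof.eq184`) and dividing by `η²` gives (1.88) (`Y − A_μ(x) = η(D*_μA_μ)(x)`,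
`R(U₀(x, x − ηe_μ))(D_μλ)(x − ηe_μ) = −(D*_μλ)(x)`, additivity of `g(i ad_λ)`).

READINGS (recorded; (R2) is the audit cell's located objection, not a new one).  (R1) `D*` on a Lie-algebra-valued bond
field `B` is `(D*B)(x) = Σ_μ (D^{η*}_{U₀,μ}B_μ)(x)`, the adjoint of the gradient `λ ↦ (D_μλ)_μ` for the `R`-invariant
pairing — the meaning under which (1.86) is "for example a term" of (1.88) and "D*Dλ = Δλ" (p. 91 l. 13); print does not
display this definition.  (R2) (1.89) AS PRINTED, `|𝔉₃| ≦ O(1)|Dλ||A|`, omits the `A`-FREE second-order terms: `D*η𝔉₁`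
is `O(|Dλ|²)` by (1.83) (not `O(|A||Dλ|)`), and `[D*_μ, g(i ad_λ)]D_μλ` has a non-zero second order (audit cell
`pub-balaban`, GAPS G-B8-11 (a)/(b), "objection; constants only; repair stated", kernel witness
`B8Eq186AdCommutator.G_B8_11b_witness`); at `A = 0` the printed (1.88)–(1.89) would make `D*_μ(1/iη) log(u′⁻¹R₀u′)`
EQUAL to `g(i ad_λ)D*Dλ`, which is false for non-abelian `𝔸`.  This file therefore proves (1.88) with `𝔉₃` explicit and
the bound `norm_frakF3_le` = the printed shape `O(1)|A||Dλ|` PLUS `41(|(D*_μλ)(x)|² + |(D_μλ)(x)|²)`; nothing printed is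
weakened (the identity is exact; the printed first-order shape is kept, constant `17`), and no refutation is filed here
(the located objection is the audit cell's, 2026-08-18).  (R3) Constants `41`, `17`: admissible values on the stated
polydisc in any complete normed algebra (print: `O(1)`), from files 1–2; `|R(U₀(x, x − ηe_μ))A_μ(x − ηe_μ)| =
|A_μ(x − ηe_μ)|` for `U₀` with values in `U1 ⊇ U(N)` (`eq188_printed`).  (R4) The smallness hypotheses are bond-local
instances of (1.77) and (1.69) (`η·α₄(Lʲη)⁻¹ = α₄L⁻ʲ ≤ α₄`, "α₄ sufficiently small").  NOT DONE HERE: (1.90); (1.86)–(1.87)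
(in `B8Eq186AdCommutator`); the refinement `𝔉₁ = O(|λ||Dλ|²)`.
-/

noncomputable section

open NormedSpace Set Filter Topology Metric
open Complex (I I_ne_zero)

namespace Literature.MathematicalPhysics.QuantumFieldTheory.Balaban1983to89.B8Eq188Proof

open MatrixLog B7BlockAvgLog B7Eq38Remainder B8Eq182Proof B8Eq184Proof
open B7Prop1Explicit (e expUnit val_expUnit val_inv_expUnit U1)
open B7Eq78Linearization (conjR conjR_apply conjR_add conjR_sub conjR_smul conjR_smul_real conjR_one)
open B7Eq92Concrete (Rc Rc_apply Rc_inv_apply mgauge mgauge_apply expUnit_conj mlog_Rc)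
open B8Ineq132 (covDerivFwd covDeriv conjR_conjR one_conjR conjR_sum norm_conjR)
open B8Eq146AExpansion (conjR_neg)
open B8Eq151V2Divergence (eta_smul_covDeriv covDeriv_eq_neg_conjR_covDerivFwd norm_covDeriv_eq)

export B7Prop1Explicit (Site) -- the `ℤ^d` sites of the b07 lineage (not the torus sites of `Setup.lean`)

variable {d : ℕ} {𝔸 : Type*} [NormedRing 𝔸] [NormedAlgebra ℂ 𝔸] [NormOneClass 𝔸] [CompleteSpace 𝔸]

/-! ## §1 `g(i ad_Y)` is additive in its argument ([3] (40): it is `(1/i)·D exp_{iY}(i·)·e^{−iY}` conjugated) -/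

section GAdLinear

omit [NormOneClass 𝔸] in
/-- `g(i ad_Y)(X₁ + X₂) = g(i ad_Y)X₁ + g(i ad_Y)X₂` (`|Y| ≤ 1/12`): the linear term of [3] (40)/(41) is the differential
of `exp` (`B7Eq38Remainder.deriv_Z39_eq`), a linear map. [cite: Balaban1985Averaging, (40)–(41) p.23] -/
theorem gAd_add (X₁ X₂ : 𝔸) {Y : 𝔸} (hY : ‖Y‖ ≤ 1 / 12) : gAd (X₁ + X₂) Y = gAd X₁ Y + gAd X₂ Y := by
  have hY' : ‖(I • Y : 𝔸)‖ ≤ 1 / 12 := by rwa [norm_I_smul']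
  have h1 : G40 (X₁ + X₂) Y = G40 X₁ Y + G40 X₂ Y := by
    rw [G40, G40, G40, deriv_Z39_eq (I • (X₁ + X₂)) hY', deriv_Z39_eq (I • X₁) hY', deriv_Z39_eq (I • X₂) hY',
      smul_add, map_add, add_mul, smul_add]
  rw [gAd, gAd, gAd, h1, conjR_add]

omit [NormOneClass 𝔸] in
/-- `g(i ad_Y)0 = 0` (`|Y| ≤ 1/12`). [cite: Balaban1985Averaging, (40)–(41) p.23] -/
theorem gAd_zero {Y : 𝔸} (hY : ‖Y‖ ≤ 1 / 12) : gAd (0 : 𝔸) Y = 0 := by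
  have h := gAd_smul_real 0 (0 : 𝔸) hY
  rwa [zero_smul, zero_smul] at h

omit [NormOneClass 𝔸] in
/-- `g(i ad_Y)(−X) = −g(i ad_Y)X` (`|Y| ≤ 1/12`). [cite: Balaban1985Averaging, (40)–(41) p.23] -/
theorem gAd_neg (X : 𝔸) {Y : 𝔸} (hY : ‖Y‖ ≤ 1 / 12) : gAd (-X) Y = -gAd X Y := by
  have h := gAd_smul_real (-1) X hY
  rwa [neg_one_smul, neg_one_smul] at h

omit [NormOneClass 𝔸] in
/-- `g(i ad_Y)(Σᵢ Xᵢ) = Σᵢ g(i ad_Y)Xᵢ` (`|Y| ≤ 1/12`) — used to sum (1.88) over the directions `μ`.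
[cite: Balaban1985Averaging, (40)–(41) p.23] -/
theorem gAd_sum {ι : Type*} (s : Finset ι) (X : ι → 𝔸) {Y : 𝔸} (hY : ‖Y‖ ≤ 1 / 12) :
    gAd (∑ i ∈ s, X i) Y = ∑ i ∈ s, gAd (X i) Y := by
  classical
  refine Finset.induction_on s ?_ ?_
  · rw [Finset.sum_empty, Finset.sum_empty, gAd_zero hY]
  · intro i s hi ih
    rw [Finset.sum_insert hi, Finset.sum_insert hi, gAd_add _ _ hY, ih]

end GAdLinear

/-! ## §2 The one-variable identity behind (1.88): `(1/i) log(e^{−i(λ+ηa)}e^{iηY}e^{iλ})` with the SAME `λ` in every slot -/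

section Algebra

omit [NormOneClass 𝔸] in
/-- THE KEY REGROUPING (exact, for all `η`, `λ`, `a`, `Y`): `e^{−i(λ+ηa)}·e^{iηY}·e^{iλ} = (E⁻¹M)⁻¹` with
`M = e^{−iλ}e^{iλ+iηa}` (the product of (1.82) at `X = ηa`) and `E = e^{iηR(e^{−iλ})Y}` (the factor of (1.84) at
`A_b ↦ Y`).  [cite: Balaban1985RegularSpaces, (1.81)–(1.84) p.90, (1.88) p.91] -/
theorem transported_arg_eq (η : ℝ) (l a Y : 𝔸) :
    (expUnit (I • (l + η • a)))⁻¹ * expUnit (I • (η • Y)) * expUnit (I • l) =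
      ((expUnit (I • (η • conjR (expUnit (-(I • l))) Y)))⁻¹ *
        (expUnit (-(I • l)) * expUnit (I • l + I • (η • a))))⁻¹ := by
  have hE : expUnit (I • (η • conjR (expUnit (-(I • l))) Y)) =
      Rc (expUnit (-(I • l))) (expUnit (I • (η • Y))) := by
    rw [← conjR_smul_real, ← conjR_smul, conjR_apply, expUnit_conj]
  rw [hE, Rc_apply, smul_add, ← val_inv_expUnit (I • l)]
  group

/-- **The identity behind (1.88)** (`λ = l`, `a = (D*_μλ)(x)`, `Y = R(U₀(x, x − ηe_μ))A_μ(x − ηe_μ)`): for `η > 0`,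
`|λ| ≤ 1/12`, `η|a| ≤ 1/70`, `η|Y| ≤ 1/12`,
`(1/i) log(e^{−i(λ+ηa)}e^{iηY}e^{iλ}) = ηR(e^{−iλ})Y − ηg(i ad_λ)a − η²𝔉₁(λ, a) − η²𝔉₂(λ, a, −Y)` — by `transported_arg_eq`,
`log X⁻¹ = −log X` ([3] (21)/(26)) and the expansions (1.82) ([3] (41): `B8Eq182Proof.eq182_alg`) and (1.84) ([3] (31): the
definition of `B8Eq182Proof.F185`). [cite: Balaban1985RegularSpaces, (1.82)–(1.85) p.90, (1.88) p.91] -/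
theorem eq188_alg {η : ℝ} (hη : 0 < η) {l a Y : 𝔸} (hl : ‖l‖ ≤ 1 / 12) (ha : η * ‖a‖ ≤ 1 / 70)
    (hY : η * ‖Y‖ ≤ 1 / 12) :
    (I⁻¹ : ℂ) • mlog (((expUnit (I • (l + η • a)))⁻¹ * expUnit (I • (η • Y)) * expUnit (I • l) : 𝔸ˣ) : 𝔸) =
      η • conjR (expUnit (-(I • l))) Y - η • gAd a l - η ^ 2 • frakF1 η l a - η ^ 2 • frakF2 η l a (-Y) := by
  have hη0 : η ≠ 0 := hη.ne'
  have hη2 : (η ^ 2 : ℝ) ≠ 0 := pow_ne_zero 2 hη0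
  have hXn : ‖(η • a : 𝔸)‖ ≤ 1 / 70 := by rw [norm_smul, Real.norm_eq_abs, abs_of_pos hη]; exact ha
  have hX3 : ‖(η • a : 𝔸)‖ < 1 / 3 := hXn.trans_lt (by norm_num)
  rw [transported_arg_eq]
  set a'' : 𝔸 := η • conjR (expUnit (-(I • l))) Y with ha''
  set N : 𝔸ˣ := (expUnit (I • a''))⁻¹ * (expUnit (-(I • l)) * expUnit (I • l + I • (η • a))) with hN
  -- the value of `N = E⁻¹M`: `e^{−ia″}·e^{iW}`, `W = W182 (ηa) λ` (by (1.82) as a group identity, `exp_I_W182`)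
  have hNval : (N : 𝔸) = exp (I • (-a'')) * exp (I • W182 (η • a) l) := by
    rw [hN, Units.val_mul, Units.val_mul, val_inv_expUnit, val_expUnit, val_expUnit, val_expUnit, smul_neg,
      exp_I_W182 hX3.le hl]
  -- smallness: `‖a″‖ ≤ 13/120`, `‖W‖ ≤ 1/10`, so `‖N − 1‖ ≤ e^{1/4} − 1 < 1/2`
  have hexp : ∀ Z : 𝔸, ‖exp Z‖ ≤ Real.exp ‖Z‖ := fun Z => by
    have h := Literature.Analysis.Calculus.norm_exp_sub_one_le Z
    calc ‖exp Z‖ = ‖(exp Z - 1) + 1‖ := by rw [sub_add_cancel]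
      _ ≤ ‖exp Z - 1‖ + ‖(1 : 𝔸)‖ := norm_add_le _ _
      _ ≤ (Real.exp ‖Z‖ - 1) + 1 := by rw [norm_one]; linarith
      _ = Real.exp ‖Z‖ := by ring
  have hT : ‖conjR (expUnit (-(I • l))) Y‖ ≤ 13 / 10 * ‖Y‖ := by
    rw [conjR_apply, val_inv_expUnit, val_expUnit, val_expUnit, neg_neg]
    have e1 : ‖exp (-(I • l))‖ ≤ Real.exp (1 / 12) :=
      (hexp _).trans (Real.exp_le_exp.mpr (by rw [norm_neg, norm_I_smul']; exact hl))
    have e2 : ‖exp (I • l)‖ ≤ Real.exp (1 / 12) :=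
      (hexp _).trans (Real.exp_le_exp.mpr (by rw [norm_I_smul']; exact hl))
    have e3 : Real.exp (1 / 12) * Real.exp (1 / 12) ≤ 13 / 10 := by
      rw [← Real.exp_add]
      exact (Real.exp_le_exp.mpr (by norm_num)).trans exp_quarter_le
    have hYn := norm_nonneg Y
    calc ‖exp (-(I • l)) * Y * exp (I • l)‖ ≤ ‖exp (-(I • l))‖ * ‖Y‖ * ‖exp (I • l)‖ :=
          (norm_mul_le _ _).trans (mul_le_mul_of_nonneg_right (norm_mul_le _ _) (norm_nonneg _))
      _ ≤ Real.exp (1 / 12) * ‖Y‖ * Real.exp (1 / 12) := by gcongr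
      _ = (Real.exp (1 / 12) * Real.exp (1 / 12)) * ‖Y‖ := by ring
      _ ≤ 13 / 10 * ‖Y‖ := mul_le_mul_of_nonneg_right e3 hYn
  have ha''n : ‖a''‖ ≤ 13 / 120 := by
    rw [ha'', norm_smul, Real.norm_eq_abs, abs_of_pos hη]
    nlinarith [norm_nonneg Y, norm_nonneg (conjR (expUnit (-(I • l))) Y)]
  have hWn : ‖W182 (η • a) l‖ ≤ 1 / 10 := (norm_W182_le hX3 hl).trans (by linarith)
  have hN1 : ‖(N : 𝔸) - 1‖ < 1 / 2 := by
    rw [hNval]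
    have h := norm_exp_mul_exp_sub_one_le (I • (-a'') : 𝔸) (I • W182 (η • a) l)
    have hs : ‖(I • (-a'') : 𝔸)‖ + ‖(I • W182 (η • a) l : 𝔸)‖ ≤ 1 / 4 := by
      rw [norm_I_smul', norm_I_smul', norm_neg]; linarith
    have he : Real.exp (‖(I • (-a'') : 𝔸)‖ + ‖(I • W182 (η • a) l : 𝔸)‖) ≤ 13 / 10 :=
      (Real.exp_le_exp.mpr hs).trans exp_quarter_le
    linarith
  -- `log N⁻¹ = −log N` for the series (21) of [3] (`N = e^{log N}`, `N⁻¹ = e^{−log N}`, `‖log N‖ < ln 2`)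
  have hinv : mlog (((N⁻¹ : 𝔸ˣ)) : 𝔸) = -mlog (N : 𝔸) := by
    have hX1 : ‖(N : 𝔸) - 1‖ < 1 := hN1.trans (by norm_num)
    have hunit : N = expUnit (mlog (N : 𝔸)) := Units.ext (by rw [val_expUnit, exp_mlog hX1])
    have hinv' : (((N⁻¹ : 𝔸ˣ) : 𝔸)) = exp (-mlog (N : 𝔸)) := by
      rw [hunit, val_inv_expUnit, val_expUnit, ← hunit]
    have hnorm : ‖-mlog (N : 𝔸)‖ < Real.log 2 := by
      rw [norm_neg]
      refine (norm_mlog_le_neg_log hX1).trans_lt ?_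
      have h2 : Real.log 2⁻¹ < Real.log (1 - ‖(N : 𝔸) - 1‖) := Real.log_lt_log (by norm_num) (by linarith)
      rw [Real.log_inv] at h2
      linarith
    rw [hinv', mlog_exp hnorm]
  -- the two printed expansions, at `X = ηa`, `a ↦ −a″`
  have hF : (I⁻¹ : ℂ) • mlog (N : 𝔸) = -a'' + W182 (η • a) l + F185 (-a'') (η • a) l := by
    rw [hNval, F185, smul_sub, smul_sub, smul_smul, smul_smul, inv_mul_cancel₀ I_ne_zero, one_smul, one_smul]
    abel
  have hW : W182 (η • a) l = η • gAd a l + η ^ 2 • frakF1 η l a := by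
    rw [eq182_alg hX3 hl, gAd_smul_real η a hl, frakF1, smul_smul, mul_inv_cancel₀ hη2, one_smul]
  have hF2 : F185 (-a'') (η • a) l = η ^ 2 • frakF2 η l a (-Y) := by
    rw [frakF2, conjR_neg, smul_neg, ← ha'', smul_smul, mul_inv_cancel₀ hη2, one_smul]
  rw [hinv, smul_neg, hF, hW, hF2]
  abel

end Algebra

/-! ## §3 (1.88)–(1.89) on the lattice `ℤᵈ` -/

section Lattice

/-- **`(1/iη) log U₁^{u′⁻¹}`** as a bond field on `ℤᵈ` (the left-hand side of (1.84), the argument of `D*` in (1.80) and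
(1.88)): `(y, μ) ↦ η⁻¹·(1/i) log (U₁^{u′⁻¹})_{⟨y, y + ηe_μ⟩}`, `log` = the series (21) of [3].
[cite: Balaban1985RegularSpaces, (1.80), (1.84) p.90, (1.88) p.91] -/
def logCfg (η : ℝ) (U₀ : Site d → Fin d → 𝔸ˣ) (lam : Site d → 𝔸) (A : Site d → Fin d → 𝔸) (y : Site d)
    (μ : Fin d) : 𝔸 :=
  η⁻¹ • ((I⁻¹ : ℂ) • mlog ((mgauge U₀ (fun z => (gaugeExp lam z)⁻¹) (cfgExp η A) y μ : 𝔸ˣ) : 𝔸))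

/-- **The remainder `𝔉₃` of (1.88), per direction `μ`, EXPLICIT** [NOT a printed formula — print leaves `𝔉₃` unnamed
beyond "depends on (Dλ)(b), A_b for b ∈ st(x)"]: with `a = (D*_μλ)(x)`, `D = (D_μλ)(x)`,
`Y = R(U₀(x, x − ηe_μ))A_μ(x − ηe_μ)`:  `𝔉₃,μ(x) = −𝔉₁(λ(x), a) − 𝔉₁(λ(x), D) − 𝔉₂(λ(x), a, −Y) − 𝔉₂(λ(x), D, A_μ(x))`
(`𝔉₁`, `𝔉₂` the remainders of (1.82)/(1.84), `B8Eq182Proof.frakF1/frakF2`).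
[cite: Balaban1985RegularSpaces, (1.88)–(1.89) p.91] -/
def frakF3 (η : ℝ) (U₀ : Site d → Fin d → 𝔸ˣ) (lam : Site d → 𝔸) (A : Site d → Fin d → 𝔸) (x : Site d)
    (μ : Fin d) : 𝔸 :=
  -(frakF1 η (lam x) (covDeriv η U₀ μ lam x) + frakF1 η (lam x) (covDerivFwd η U₀ μ lam x) +
      frakF2 η (lam x) (covDeriv η U₀ μ lam x) (-conjR (U₀ (x - e μ) μ)⁻¹ (A (x - e μ) μ)) +
      frakF2 η (lam x) (covDerivFwd η U₀ μ lam x) (A x μ))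

omit [NormOneClass 𝔸] in
/-- **The transport of (1.81) from the bond `⟨x − ηe_μ, x⟩` to `x`** (exact, every `η ≠ 0`, `U₀`, `λ`, `A`):
`R(U₀(x, x − ηe_μ))[u′⁻¹(x − ηe_μ)·U₁(x − ηe_μ, x)·R₀u′(x)] = e^{−i(λ(x) + η(D*_μλ)(x))}·e^{iηR(U₀(x, x−ηe_μ))A_μ(x−ηe_μ)}·e^{iλ(x)}`
(by (1.1): `R(U₀(x, x − ηe_μ))λ(x − ηe_μ) = λ(x) + η(D*_μλ)(x)`, and `R` is an automorphism commuting with `exp`,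
[3] (57)). [cite: Balaban1985RegularSpaces, (1.81) p.90, (1.86) p.91, (1.1) p.76] -/
theorem Rc_mgauge_shift {η : ℝ} (hη : η ≠ 0) (U₀ : Site d → Fin d → 𝔸ˣ) (lam : Site d → 𝔸)
    (A : Site d → Fin d → 𝔸) (x : Site d) (μ : Fin d) :
    Rc (U₀ (x - e μ) μ)⁻¹ (mgauge U₀ (fun y => (gaugeExp lam y)⁻¹) (cfgExp η A) (x - e μ) μ) =
      (expUnit (I • (lam x + η • covDeriv η U₀ μ lam x)))⁻¹ *
        expUnit (I • (η • conjR (U₀ (x - e μ) μ)⁻¹ (A (x - e μ) μ))) * expUnit (I • lam x) := by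
  rw [eq181_first, sub_add_cancel, map_mul, map_mul, map_inv]
  have h1 : Rc (U₀ (x - e μ) μ)⁻¹ (gaugeExp lam (x - e μ)) =
      expUnit (I • (lam x + η • covDeriv η U₀ μ lam x)) := by
    rw [gaugeExp, ← expUnit_conj, ← conjR_apply, conjR_smul, eta_smul_covDeriv hη, add_sub_cancel]
  have h2 : Rc (U₀ (x - e μ) μ)⁻¹ (cfgExp η A (x - e μ) μ) =
      expUnit (I • (η • conjR (U₀ (x - e μ) μ)⁻¹ (A (x - e μ) μ))) := by
    rw [cfgExp, ← expUnit_conj, ← conjR_apply, conjR_smul, conjR_smul_real]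
  have h3 : Rc (U₀ (x - e μ) μ)⁻¹ (Rc (U₀ (x - e μ) μ) (gaugeExp lam x)) = gaugeExp lam x :=
    (Rc_inv_apply (U₀ (x - e μ) μ) _).1
  rw [h1, h2, h3, gaugeExp]

omit [NormOneClass 𝔸] in
/-- The transported `(1/iη) log`: `R(U₀(x, x − ηe_μ))Φ_μ(x − ηe_μ) = (1/iη) log` of the transported bond variable of
`Rc_mgauge_shift` (`log` commutes with `R`: [3] (57), `B7Eq92Concrete.mlog_Rc`).
[cite: Balaban1985RegularSpaces, (1.86) p.91; Balaban1985Averaging, (57) p.27] -/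
theorem conjR_logCfg_shift {η : ℝ} (hη : η ≠ 0) (U₀ : Site d → Fin d → 𝔸ˣ) (lam : Site d → 𝔸)
    (A : Site d → Fin d → 𝔸) (x : Site d) (μ : Fin d) :
    conjR (U₀ (x - e μ) μ)⁻¹ (logCfg η U₀ lam A (x - e μ) μ) =
      η⁻¹ • ((I⁻¹ : ℂ) • mlog (((expUnit (I • (lam x + η • covDeriv η U₀ μ lam x)))⁻¹ *
        expUnit (I • (η • conjR (U₀ (x - e μ) μ)⁻¹ (A (x - e μ) μ))) * expUnit (I • lam x) : 𝔸ˣ) : 𝔸)) := by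
  rw [logCfg, conjR_smul_real, conjR_smul, conjR_apply, ← mlog_Rc, Rc_mgauge_shift hη]

/-- **(1.88), direction by direction, EXACT** (row B8.Eq1.87): for `η > 0`, `|λ(x)| ≤ 1/12`, `η|(D_μλ)(x)| ≤ 1/70`,
`η|(D*_μλ)(x)| ≤ 1/70`, `η|R(U₀(x, x − ηe_μ))A_μ(x − ηe_μ)| ≤ 1/12`:
`D*_μ[(1/iη) log (U₁^{u′⁻¹})_{(·,μ)}](x) = e^{−i ad_{λ(x)}}(D*_μA_μ)(x) + g(i ad_{λ(x)})(D*_μD_μλ)(x) + 𝔉₃,μ(x)`.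
[cite: Balaban1985RegularSpaces, (1.88) p.91] -/
theorem eq188_dir {η : ℝ} (hη : 0 < η) (U₀ : Site d → Fin d → 𝔸ˣ) {lam : Site d → 𝔸} (A : Site d → Fin d → 𝔸)
    {x : Site d} (μ : Fin d) (hl : ‖lam x‖ ≤ 1 / 12) (hD : η * ‖covDerivFwd η U₀ μ lam x‖ ≤ 1 / 70)
    (ha : η * ‖covDeriv η U₀ μ lam x‖ ≤ 1 / 70)
    (hY : η * ‖conjR (U₀ (x - e μ) μ)⁻¹ (A (x - e μ) μ)‖ ≤ 1 / 12) :
    covDeriv η U₀ μ (fun y => logCfg η U₀ lam A y μ) x =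
      conjR (gaugeExp lam x)⁻¹ (covDeriv η U₀ μ (fun y => A y μ) x) +
        gAd (covDeriv η U₀ μ (covDerivFwd η U₀ μ lam) x) (lam x) + frakF3 η U₀ lam A x μ := by
  have hη0 : η ≠ 0 := hη.ne'
  have hu : (gaugeExp lam x)⁻¹ = expUnit (-(I • lam x)) := by rw [gaugeExp, val_inv_expUnit]
  -- the transported term at `x − ηe_μ`, by `eq188_alg`
  have h1 : conjR (U₀ (x - e μ) μ)⁻¹ (logCfg η U₀ lam A (x - e μ) μ) =
      conjR (expUnit (-(I • lam x))) (conjR (U₀ (x - e μ) μ)⁻¹ (A (x - e μ) μ)) -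
        gAd (covDeriv η U₀ μ lam x) (lam x) - η • frakF1 η (lam x) (covDeriv η U₀ μ lam x) -
        η • frakF2 η (lam x) (covDeriv η U₀ μ lam x) (-conjR (U₀ (x - e μ) μ)⁻¹ (A (x - e μ) μ)) := by
    rw [conjR_logCfg_shift hη0, eq188_alg hη hl ha hY]
    simp only [smul_sub, smul_smul, pow_two, ← mul_assoc, inv_mul_cancel₀ hη0, one_mul, one_smul]
  -- the term at `x`, by (1.84)
  have h2 : logCfg η U₀ lam A x μ =
      conjR (expUnit (-(I • lam x))) (A x μ) + gAd (covDerivFwd η U₀ μ lam x) (lam x) +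
        η • frakF1 η (lam x) (covDerivFwd η U₀ μ lam x) +
        η • frakF2 η (lam x) (covDerivFwd η U₀ μ lam x) (A x μ) := by
    rw [logCfg, eq184 hη U₀ A μ hl hD, hu]
  -- `(D*_μD_μλ)(x) = η⁻¹(−a − D)` and `(D*_μA_μ)(x) = η⁻¹(Y − A_μ(x))`
  have h3 : covDeriv η U₀ μ (covDerivFwd η U₀ μ lam) x =
      η⁻¹ • (conjR (U₀ (x - e μ) μ)⁻¹ (covDerivFwd η U₀ μ lam (x - e μ)) - covDerivFwd η U₀ μ lam x) := rfl
  have h3' : conjR (U₀ (x - e μ) μ)⁻¹ (covDerivFwd η U₀ μ lam (x - e μ)) = -covDeriv η U₀ μ lam x := by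
    rw [covDeriv_eq_neg_conjR_covDerivFwd, neg_neg]
  have h4 : covDeriv η U₀ μ (fun y => A y μ) x =
      η⁻¹ • (conjR (U₀ (x - e μ) μ)⁻¹ (A (x - e μ) μ) - A x μ) := rfl
  have h0 : covDeriv η U₀ μ (fun y => logCfg η U₀ lam A y μ) x =
      η⁻¹ • (conjR (U₀ (x - e μ) μ)⁻¹ (logCfg η U₀ lam A (x - e μ) μ) - logCfg η U₀ lam A x μ) := rfl
  have hg : gAd (-covDeriv η U₀ μ lam x - covDerivFwd η U₀ μ lam x) (lam x) =
      -gAd (covDeriv η U₀ μ lam x) (lam x) - gAd (covDerivFwd η U₀ μ lam x) (lam x) := by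
    rw [sub_eq_add_neg, gAd_add _ _ hl, gAd_neg _ hl, gAd_neg _ hl, ← sub_eq_add_neg]
  rw [h0, h1, h2, h3, h3', h4, hu, conjR_smul_real, conjR_sub, gAd_smul_real _ _ hl, hg, frakF3]
  simp only [smul_sub, smul_add, smul_neg, smul_smul, inv_mul_cancel₀ hη0, one_smul]
  abel

/-- **(1.89), with constants and with the `A`-free second order kept** (READING (R2)): for `η > 0`, `|λ(x)| ≤ 1/12`,
`η|(D_μλ)(x)|, η|(D*_μλ)(x)| ≤ 1/70`, `η|A_μ(x)|, η|R(U₀(x, x − ηe_μ))A_μ(x − ηe_μ)| ≤ 1/12`,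
`|𝔉₃,μ(x)| ≤ 41(|(D*_μλ)(x)|² + |(D_μλ)(x)|²) + 17(|R(U₀(x, x−ηe_μ))A_μ(x−ηe_μ)|·|(D*_μλ)(x)| + |A_μ(x)|·|(D_μλ)(x)|)`
(printed: `|𝔉₃| ≦ O(1)|Dλ||A|`). [cite: Balaban1985RegularSpaces, (1.89) p.91, (1.83), (1.85) p.90] -/
theorem norm_frakF3_le {η : ℝ} (hη : 0 < η) (U₀ : Site d → Fin d → 𝔸ˣ) {lam : Site d → 𝔸}
    (A : Site d → Fin d → 𝔸) {x : Site d} (μ : Fin d) (hl : ‖lam x‖ ≤ 1 / 12)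
    (hD : η * ‖covDerivFwd η U₀ μ lam x‖ ≤ 1 / 70) (ha : η * ‖covDeriv η U₀ μ lam x‖ ≤ 1 / 70)
    (hA : η * ‖A x μ‖ ≤ 1 / 12) (hY : η * ‖conjR (U₀ (x - e μ) μ)⁻¹ (A (x - e μ) μ)‖ ≤ 1 / 12) :
    ‖frakF3 η U₀ lam A x μ‖ ≤
      41 * ‖covDeriv η U₀ μ lam x‖ ^ 2 + 41 * ‖covDerivFwd η U₀ μ lam x‖ ^ 2 +
        17 * ‖conjR (U₀ (x - e μ) μ)⁻¹ (A (x - e μ) μ)‖ * ‖covDeriv η U₀ μ lam x‖ +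
        17 * ‖A x μ‖ * ‖covDerivFwd η U₀ μ lam x‖ := by
  have h1 := norm_frakF1_le hη hl (D := covDeriv η U₀ μ lam x) (by linarith)
  have h2 := norm_frakF1_le hη hl (D := covDerivFwd η U₀ μ lam x) (by linarith)
  have h3 := norm_frakF2_le hη hl ha (Ab := -conjR (U₀ (x - e μ) μ)⁻¹ (A (x - e μ) μ)) (by rwa [norm_neg])
  have h4 := norm_frakF2_le hη hl hD hA
  rw [norm_neg] at h3
  rw [frakF3, norm_neg]
  refine (norm_add_le _ _).trans ((add_le_add norm_add₃_le le_rfl).trans ?_)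
  linarith

/-- **(1.88) AS PRINTED (summed over the directions) — `(D*(1/iη) log U₁^{u′⁻¹})(x) = e^{−i ad_{λ(x)}}(D*A)(x) +
g(i ad_{λ(x)})(D*Dλ)(x) + 𝔉₃(λ(x), Dλ, A)` with `𝔉₃ = Σ_μ 𝔉₃,μ`** (READING (R1): `D* = Σ_μ D*_μ` on bond fields), under
the hypotheses of `eq188_dir` in every direction. [cite: Balaban1985RegularSpaces, (1.88) p.91] -/
theorem eq188 {η : ℝ} (hη : 0 < η) (U₀ : Site d → Fin d → 𝔸ˣ) {lam : Site d → 𝔸} (A : Site d → Fin d → 𝔸)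
    {x : Site d} (hl : ‖lam x‖ ≤ 1 / 12) (hD : ∀ μ, η * ‖covDerivFwd η U₀ μ lam x‖ ≤ 1 / 70)
    (ha : ∀ μ, η * ‖covDeriv η U₀ μ lam x‖ ≤ 1 / 70)
    (hY : ∀ μ, η * ‖conjR (U₀ (x - e μ) μ)⁻¹ (A (x - e μ) μ)‖ ≤ 1 / 12) :
    ∑ μ, covDeriv η U₀ μ (fun y => logCfg η U₀ lam A y μ) x =
      conjR (gaugeExp lam x)⁻¹ (∑ μ, covDeriv η U₀ μ (fun y => A y μ) x) +
        gAd (∑ μ, covDeriv η U₀ μ (covDerivFwd η U₀ μ lam) x) (lam x) + ∑ μ, frakF3 η U₀ lam A x μ := by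
  rw [conjR_sum, gAd_sum _ _ hl, ← Finset.sum_add_distrib, ← Finset.sum_add_distrib]
  exact Finset.sum_congr rfl fun μ _ => eq188_dir hη U₀ A μ hl (hD μ) (ha μ) (hY μ)

/-- **(1.88)–(1.89) in the printed variables** — for a background with `U₀(x − ηe_μ, x)` in the norm-one subgroup
`U1 ⊇ U(N)` (so that `|(D*_μλ)(x)| = |(Dλ)(⟨x − ηe_μ, x⟩)|`, `|R(U₀(x, x − ηe_μ))A_μ(x − ηe_μ)| = |A_μ(x − ηe_μ)|`): under
`η > 0`, `|λ(x)| ≤ 1/12`, `η|(Dλ)(b)| ≤ 1/70` and `η|A_b| ≤ 1/12` for the two bonds `b = ⟨x, x + ηe_μ⟩, ⟨x − ηe_μ, x⟩ ∈ st(x)`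
of direction `μ`, the identity (1.88) in direction `μ` holds with
`|𝔉₃,μ(x)| ≤ 41(|(Dλ)(x−ηe_μ, x)|² + |(Dλ)(x, x+ηe_μ)|²) + 17(|A_μ(x−ηe_μ)|·|(Dλ)(x−ηe_μ, x)| + |A_μ(x)|·|(Dλ)(x, x+ηe_μ)|)`
— "`𝔉₃` depends on `(Dλ)(b)`, `A_b` for `b ∈ st(x)`", the printed shape `O(1)|Dλ||A|` plus the `A`-free squares of
READING (R2). [cite: Balaban1985RegularSpaces, (1.88)–(1.89) p.91] -/
theorem eq188_printed {η : ℝ} (hη : 0 < η) {U₀ : Site d → Fin d → 𝔸ˣ} {lam : Site d → 𝔸}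
    (A : Site d → Fin d → 𝔸) {x : Site d} {μ : Fin d} (h₀ : U₀ (x - e μ) μ ∈ U1 𝔸) (hl : ‖lam x‖ ≤ 1 / 12)
    (hD : η * ‖covDerivFwd η U₀ μ lam x‖ ≤ 1 / 70) (hDm : η * ‖covDerivFwd η U₀ μ lam (x - e μ)‖ ≤ 1 / 70)
    (hA : η * ‖A x μ‖ ≤ 1 / 12) (hAm : η * ‖A (x - e μ) μ‖ ≤ 1 / 12) :
    covDeriv η U₀ μ (fun y => logCfg η U₀ lam A y μ) x =
        conjR (gaugeExp lam x)⁻¹ (covDeriv η U₀ μ (fun y => A y μ) x) +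
          gAd (covDeriv η U₀ μ (covDerivFwd η U₀ μ lam) x) (lam x) + frakF3 η U₀ lam A x μ ∧
      ‖frakF3 η U₀ lam A x μ‖ ≤
        41 * ‖covDerivFwd η U₀ μ lam (x - e μ)‖ ^ 2 + 41 * ‖covDerivFwd η U₀ μ lam x‖ ^ 2 +
          17 * ‖A (x - e μ) μ‖ * ‖covDerivFwd η U₀ μ lam (x - e μ)‖ +
          17 * ‖A x μ‖ * ‖covDerivFwd η U₀ μ lam x‖ := by
  have hn1 : ‖covDeriv η U₀ μ lam x‖ = ‖covDerivFwd η U₀ μ lam (x - e μ)‖ := norm_covDeriv_eq h₀ lam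
  have hn2 : ‖conjR (U₀ (x - e μ) μ)⁻¹ (A (x - e μ) μ)‖ = ‖A (x - e μ) μ‖ := norm_conjR ((U1 𝔸).inv_mem h₀) _
  have ha : η * ‖covDeriv η U₀ μ lam x‖ ≤ 1 / 70 := by rwa [hn1]
  have hY : η * ‖conjR (U₀ (x - e μ) μ)⁻¹ (A (x - e μ) μ)‖ ≤ 1 / 12 := by rwa [hn2]
  refine ⟨eq188_dir hη U₀ A μ hl hD ha hY, ?_⟩
  have h := norm_frakF3_le hη U₀ A μ hl hD ha hA hY
  rwa [hn1, hn2] at h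

end Lattice

end Literature.MathematicalPhysics.QuantumFieldTheory.Balaban1983to89.B8Eq188Proof
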